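import Summits.QuantumFields.GaugeBoot.TiltedLinkRPPlaquettes
import HarnessLib

/-!
# Link (mid-plane) reflections on a periodic lattice: holonomies, the action, the measure (gauge-boot, L3(υ) part 3)

HONEST FRAMING (cell `pub-gaugeboot`, page 1 of every file): the venture produces certified bounds
on lattice expectations at stated coupling, gauge group, dimension and torus size; NOT a mass gap,
NOT a continuum limit, NOT a string tension; NOT Yang–Mills-summit-bearing (barriers
`FixedCouplingUltralocality`, `PerturbativeInvisibility`).

Continuation of `TiltedLinkRPPlaquettes.lean` (periodic lattice `(A, e)` with a site frame
`IsSiteFrame e k σ Q h`, mid-plane reflection `θ x = σ x + e k`, `Θ = configMidReflect e k σ`):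

* plaquette holonomies under `Θ`: for a plaquette without `k`-side `(ΘU)_{x;l,m} = U_{θx;l,m}`,
  for a plaquette with a `k`-side `(ΘU)_p = a⁻¹ · (U_{p'})⁻¹ · a` with `p' = plaqMidReflect p`
  (base point `σ x`) and `a = U(σ x, k)` — so `Re tr ρ((ΘU)_p) = Re tr ρ(U_{p'})`
  (`plaqObs_configMidReflect`; conjugation invariance and `Re tr ρ(g⁻¹) = Re tr ρ(g)` on a compact
  group, `Literature.RepresentationTheory.CompactGroups.UnitaryTrick`);
* the orientation of a plaquette with a `k`-side is immaterial for `Re tr`: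
  `plaqObs ρ e p V = Re tr ρ(V_{x; k, m})`, `m = otherDir k p` (`plaqObs_of_hasDir`);
* the splitting of the plaquette sum `∑_p Re tr ρ(U_p) = A(U) + A(ΘU) + X(U)` into positive part,
  reflected positive part and CROSSING part (`sum_plaqObs_split_mid`), and `S(ΘU) = S(U)`;
* `Θ` preserves the product Haar measure (relabelling of the links by the involution `midLinkMap`
  composed with inversion of the `k`-link variables; Haar measure on a compact group is inversion
  invariant) and is measurable.

References: K. Osterwalder, E. Seiler, Ann. Phys. 110 (1978) 440, §2; E. Seiler, LNP 159 (1982)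
Thm. 2.2.
-/

noncomputable section

open MeasureTheory
open Literature.MathematicalPhysics.QuantumFieldTheory (haarProbability)
open Literature.RepresentationTheory.CompactGroups

namespace Summit.QuantumFields.GaugeBoot

namespace TiltedRP

namespace IsSiteFrame

variable {A : Type*} [AddCommGroup A] [Fintype A] {d : ℕ}
variable {e : Fin d → A} {k : Fin d} {σ : A →+ A} {Q : ℕ} {h : A →+ ZMod (2 * Q)}
variable (hF : IsSiteFrame e k σ Q h)
variable {N : ℕ} {G : Type*} [Group G] [TopologicalSpace G] [IsTopologicalGroup G] [CompactSpace G]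
  [MeasurableSpace G] [BorelSpace G] [SecondCountableTopology G]
variable (ρ : G →* Matrix (Fin N) (Fin N) ℂ)
include hF

/-! ## Holonomies under the mid-plane reflection -/

omit [Fintype A] [TopologicalSpace G] [IsTopologicalGroup G] [CompactSpace G] [MeasurableSpace G]
  [BorelSpace G] [SecondCountableTopology G] in
/-- A plaquette WITHOUT `k`-side: `(ΘU)_{x;l,m} = U_{θx;l,m}`. -/
theorem holonomy_configMidReflect_of_not_hasDir (U : Config A d G) {p : Plaq A d}
    (hp : ¬ HasDir p k) :
    holonomy e (configMidReflect e k σ U) p.1 p.2.1.1 p.2.1.2 =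
      holonomy e U (plaqMidReflect e k σ p).1 p.2.1.1 p.2.1.2 := by
  obtain ⟨x, ⟨⟨l, m⟩, hlm⟩⟩ := p
  simp only [HasDir, not_or] at hp
  rw [plaqMidReflect_fst_of_not_hasDir (by simpa [HasDir] using hp)]
  simp only [holonomy, configMidReflect_other e k σ _ _ hp.1, configMidReflect_other e k σ _ _ hp.2,
    hF.midReflect_add_other _ hp.1, hF.midReflect_add_other _ hp.2]

omit [Fintype A] [TopologicalSpace G] [IsTopologicalGroup G] [CompactSpace G] [MeasurableSpace G]
  [BorelSpace G] [SecondCountableTopology G] in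
/-- A `(k, m)`-plaquette: `(ΘU)_{x;k,m} = a⁻¹ · (U_{y;k,m})⁻¹ · a`, `y = σ x`, `a = U(y, k)`. -/
theorem holonomy_configMidReflect_left (U : Config A d G) (x : A) {m : Fin d} (hm : m ≠ k) :
    holonomy e (configMidReflect e k σ U) x k m =
      (U (σ x, k))⁻¹ * (holonomy e U (σ x) k m)⁻¹ * U (σ x, k) := by
  have h1 : configMidReflect e k σ U (x + e k, m) = U (σ x, m) := by
    rw [configMidReflect_other e k σ U _ hm, hF.midReflect_add_self]
  have h2 : configMidReflect e k σ U (x + e m, k) = (U (σ x + e m, k))⁻¹ := by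
    rw [configMidReflect_self, hF.map_add_other _ hm]
  have h3 : configMidReflect e k σ U (x, m) = U (σ x + e k, m) := by
    rw [configMidReflect_other e k σ U _ hm]; rfl
  simp only [holonomy, configMidReflect_self, h1, h2, h3, mul_inv_rev, inv_inv]
  group

omit [Fintype A] [TopologicalSpace G] [IsTopologicalGroup G] [CompactSpace G] [MeasurableSpace G]
  [BorelSpace G] [SecondCountableTopology G] in
/-- An `(l, k)`-plaquette: `(ΘU)_{x;l,k} = a⁻¹ · (U_{y;l,k})⁻¹ · a`, `y = σ x`, `a = U(y, k)`. -/
theorem holonomy_configMidReflect_right (U : Config A d G) (x : A) {l : Fin d} (hl : l ≠ k) :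
    holonomy e (configMidReflect e k σ U) x l k =
      (U (σ x, k))⁻¹ * (holonomy e U (σ x) l k)⁻¹ * U (σ x, k) := by
  have h1 : configMidReflect e k σ U (x + e l, k) = (U (σ x + e l, k))⁻¹ := by
    rw [configMidReflect_self, hF.map_add_other _ hl]
  have h2 : configMidReflect e k σ U (x + e k, l) = U (σ x, l) := by
    rw [configMidReflect_other e k σ U _ hl, hF.midReflect_add_self]
  have h3 : configMidReflect e k σ U (x, l) = U (σ x + e k, l) := by
    rw [configMidReflect_other e k σ U _ hl]; rfl
  simp only [holonomy, configMidReflect_self, h1, h2, h3, mul_inv_rev, inv_inv]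
  group

omit [Fintype A] [TopologicalSpace G] [IsTopologicalGroup G] [CompactSpace G] [MeasurableSpace G]
  [BorelSpace G] [SecondCountableTopology G] in
/-- A plaquette WITH a `k`-side: `(ΘU)_p = a⁻¹ · (U_{p'})⁻¹ · a`, `p' = plaqMidReflect p` (base
point `σ x`), `a = U(σ x, k)`. -/
theorem holonomy_configMidReflect_of_hasDir (U : Config A d G) {p : Plaq A d} (hp : HasDir p k) :
    holonomy e (configMidReflect e k σ U) p.1 p.2.1.1 p.2.1.2 =
      (U (σ p.1, k))⁻¹ * (holonomy e U (plaqMidReflect e k σ p).1 p.2.1.1 p.2.1.2)⁻¹ *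
        U (σ p.1, k) := by
  obtain ⟨x, ⟨⟨l, m⟩, hlm⟩⟩ := p
  have hlm' : l ≠ m := ne_of_lt hlm
  rw [plaqMidReflect_fst_of_hasDir hp]
  simp only [HasDir] at hp
  rcases hp with hl | hm
  · have hl' := hl.symm
    subst hl'
    exact hF.holonomy_configMidReflect_left U x (fun h' => hlm' h'.symm)
  · have hm' := hm.symm
    subst hm'
    exact hF.holonomy_configMidReflect_right U x hlm'

omit [Fintype A] [MeasurableSpace G] [BorelSpace G] [SecondCountableTopology G] in
/-- **`Re tr ρ((ΘU)_p) = Re tr ρ(U_{plaqMidReflect p})`.** -/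
theorem plaqObs_configMidReflect (hρ : Continuous ρ) (p : Plaq A d) (U : Config A d G) :
    plaqObs ρ e p (configMidReflect e k σ U) = plaqObs ρ e (plaqMidReflect e k σ p) U := by
  unfold plaqObs
  rw [plaqMidReflect_snd]
  by_cases hp : HasDir p k
  · rw [hF.holonomy_configMidReflect_of_hasDir U hp]
    set a := U (σ p.1, k)
    set g := holonomy e U (plaqMidReflect e k σ p).1 p.2.1.1 p.2.1.2
    rw [show a⁻¹ * g⁻¹ * a = a⁻¹ * g⁻¹ * a⁻¹⁻¹ by rw [inv_inv], CompactGroup.trace_conj_eq,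
      CompactGroup.re_trace_map_inv ρ hρ]
  · rw [hF.holonomy_configMidReflect_of_not_hasDir U hp]

omit [Fintype A] [MeasurableSpace G] [BorelSpace G] [SecondCountableTopology G] in
/-- `Re tr ρ((ΘU)_{plaqMidReflect p}) = Re tr ρ(U_p)`. -/
theorem plaqObs_plaqMidReflect_configMidReflect (hρ : Continuous ρ) (p : Plaq A d)
    (U : Config A d G) :
    plaqObs ρ e (plaqMidReflect e k σ p) (configMidReflect e k σ U) = plaqObs ρ e p U := by
  rw [hF.plaqObs_configMidReflect ρ hρ, hF.plaqMidReflect_plaqMidReflect]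

omit [Fintype A] [MeasurableSpace G] [BorelSpace G] [SecondCountableTopology G] hF in
/-- **The orientation of a plaquette with a `k`-side is immaterial**:
`Re tr ρ(V_p) = Re tr ρ(V_{x; k, m})`, `m = otherDir k p` (if `p = (x; m, k)` the two holonomies are
inverse to each other). -/
theorem plaqObs_of_hasDir (hρ : Continuous ρ) {p : Plaq A d} (hp : HasDir p k) (V : Config A d G) :
    plaqObs ρ e p V = ((ρ (holonomy e V p.1 k (otherDir k p))).trace).re := by
  obtain ⟨x, ⟨⟨l, m⟩, hlm⟩⟩ := p
  have hlm' : l ≠ m := ne_of_lt hlm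
  unfold plaqObs otherDir
  simp only [HasDir] at hp
  simp only
  rcases hp with hl | hm
  · subst hl
    rw [if_pos rfl]
  · subst hm
    rw [if_neg hlm', holonomy_swap_dirs, CompactGroup.re_trace_map_inv ρ hρ]

/-! ## Splitting the action -/

open scoped Classical in
omit [MeasurableSpace G] [BorelSpace G] [SecondCountableTopology G] in
/-- The negative plaquettes contribute the positive ones of the reflected configuration. -/
theorem sum_neg_eq_sum_pos_configMidReflect (hρ : Continuous ρ) (U : Config A d G) :
    ∑ p ∈ Finset.univ.filter (IsMidNegPlaq k Q h), plaqObs ρ e p U =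
      ∑ p ∈ Finset.univ.filter (IsMidPosPlaq k Q h), plaqObs ρ e p (configMidReflect e k σ U) := by
  refine Finset.sum_nbij' (plaqMidReflect e k σ) (plaqMidReflect e k σ) (fun p hp => ?_)
    (fun p hp => ?_) (fun p _ => hF.plaqMidReflect_plaqMidReflect p)
    (fun p _ => hF.plaqMidReflect_plaqMidReflect p) fun p _ => ?_
  · rw [Finset.mem_filter] at hp ⊢
    exact ⟨Finset.mem_univ _, (hF.isMidPosPlaq_plaqMidReflect_iff p).2 hp.2⟩
  · rw [Finset.mem_filter] at hp ⊢
    exact ⟨Finset.mem_univ _, (hF.isMidNegPlaq_plaqMidReflect_iff p).2 hp.2⟩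
  · rw [hF.plaqObs_plaqMidReflect_configMidReflect ρ hρ]

open scoped Classical in
omit [MeasurableSpace G] [BorelSpace G] [SecondCountableTopology G] in
/-- **Splitting of the plaquette sum along the two hyperplanes**:
`∑_p Re tr ρ(U_p) = A(U) + A(ΘU) + X(U)` (positive part, reflected positive part, crossing part). -/
theorem sum_plaqObs_split_mid (hρ : Continuous ρ) (U : Config A d G) :
    ∑ p, plaqObs ρ e p U =
      ∑ p ∈ Finset.univ.filter (IsMidPosPlaq k Q h), plaqObs ρ e p U +
      ∑ p ∈ Finset.univ.filter (IsMidPosPlaq k Q h), plaqObs ρ e p (configMidReflect e k σ U) +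
      ∑ p ∈ Finset.univ.filter (IsMidCrossPlaq k Q h), plaqObs ρ e p U := by
  rw [← hF.sum_neg_eq_sum_pos_configMidReflect ρ hρ U]
  set P : Finset (Plaq A d) := Finset.univ
  set f : Plaq A d → ℝ := fun p => plaqObs ρ e p U
  have h1 := Finset.sum_filter_add_sum_filter_not P (IsMidPosPlaq k Q h) f
  have h2 := Finset.sum_filter_add_sum_filter_not (P.filter fun p => ¬ IsMidPosPlaq k Q h p)
    (IsMidCrossPlaq k Q h) f
  have e2 : (P.filter fun p => ¬ IsMidPosPlaq k Q h p).filter (IsMidCrossPlaq k Q h) =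
      P.filter (IsMidCrossPlaq k Q h) := by
    rw [Finset.filter_filter]
    exact Finset.filter_congr fun p _ =>
      ⟨fun h' => h'.2, fun h' => ⟨fun h'' => not_isMidCrossPlaq_of_isMidPosPlaq h'' h', h'⟩⟩
  have e3 : (P.filter fun p => ¬ IsMidPosPlaq k Q h p).filter (fun p => ¬ IsMidCrossPlaq k Q h p) =
      P.filter (IsMidNegPlaq k Q h) := by
    rw [Finset.filter_filter]
    exact Finset.filter_congr fun p _ => by unfold IsMidNegPlaq; tauto
  rw [e2, e3] at h2
  linarith

omit [MeasurableSpace G] [BorelSpace G] [SecondCountableTopology G] in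
/-- **The Wilson action is reflection invariant**: `S(ΘU) = S(U)`. -/
theorem wilsonAction_configMidReflect (hρ : Continuous ρ) (U : Config A d G) :
    wilsonAction ρ e (configMidReflect e k σ U) = wilsonAction ρ e U := by
  rw [wilsonAction_eq, wilsonAction_eq]
  congr 1
  exact Fintype.sum_equiv
    (Function.Involutive.toPerm (plaqMidReflect e k σ) hF.plaqMidReflect_plaqMidReflect) _ _
    fun p => hF.plaqObs_configMidReflect ρ hρ p U

/-! ## The reflection preserves the product Haar measure -/

/-- The reflection of links as a permutation. -/
def midLinkPerm (hF : IsSiteFrame e k σ Q h) : Equiv.Perm (Link A d) :=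
  Function.Involutive.toPerm (midLinkMap e k σ) hF.midLinkMap_involutive

omit [Fintype A] [TopologicalSpace G] [IsTopologicalGroup G] [CompactSpace G] [MeasurableSpace G]
  [BorelSpace G] [SecondCountableTopology G] hF in
/-- `configMidReflect` = (invert the `k`-link variables) ∘ (relabel the links by `midLinkMap`). -/
theorem configMidReflect_eq_comp :
    (configMidReflect (G := G) e k σ : Config A d G → Config A d G) =
      (fun V l => (if l.2 = k then (fun g : G => g⁻¹) else id) (V l)) ∘
        fun U l => U (midLinkMap e k σ l) := by
  funext U l
  simp only [configMidReflect, Function.comp_apply]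
  split_ifs <;> rfl

omit [SecondCountableTopology G] in
/-- **The mid-plane reflection preserves the product Haar measure.** -/
theorem measurePreserving_configMidReflect :
    MeasurePreserving (configMidReflect (G := G) e k σ) (productHaar A d G) (productHaar A d G) := by
  haveI : IsProbabilityMeasure (haarProbability G) :=
    CompactGroup.isProbabilityMeasure_haarMeasure_top
  haveI : (haarProbability G).IsInvInvariant := by
    unfold haarProbability; exact CompactGroup.isInvInvariant_of_isHaarMeasure _
  have h1 : MeasurePreserving (fun U l => U (midLinkMap e k σ l) : Config A d G → Config A d G)
      (productHaar A d G) (productHaar A d G) := by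
    have h' := measurePreserving_arrowCongr' (fun _ : Link A d => haarProbability G)
      (fun _ : Link A d => haarProbability G) hF.midLinkPerm (MeasurableEquiv.refl G)
      fun _ => MeasurePreserving.id _
    have heq : (fun U l => U (midLinkMap e k σ l) : Config A d G → Config A d G) =
        ⇑(MeasurableEquiv.arrowCongr' hF.midLinkPerm (MeasurableEquiv.refl G)) := by
      funext U l; rfl
    rw [heq]; exact h'
  have h2 : MeasurePreserving
      (fun V l => (if l.2 = k then (fun g : G => g⁻¹) else id) (V l) : Config A d G → Config A d G)
      (productHaar A d G) (productHaar A d G) := by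
    unfold productHaar
    refine measurePreserving_pi _ _ fun l => ?_
    split_ifs
    · exact Measure.measurePreserving_inv _
    · exact MeasurePreserving.id _
  rw [configMidReflect_eq_comp]
  exact h2.comp h1

omit [Fintype A] [TopologicalSpace G] [IsTopologicalGroup G] [CompactSpace G]
  [SecondCountableTopology G] hF in
/-- The reflection of configurations is measurable. -/
theorem measurable_configMidReflect [MeasurableInv G] :
    Measurable (configMidReflect (G := G) e k σ) := by
  refine measurable_pi_lambda _ fun l => ?_
  by_cases hl : l.2 = k
  · simp only [configMidReflect, hl, ↓reduceIte]
    exact (measurable_pi_apply _).inv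
  · simp only [configMidReflect, hl, ↓reduceIte]
    exact measurable_pi_apply _

end IsSiteFrame

end TiltedRP

end Summit.QuantumFields.GaugeBoot
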